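import Literature.MathematicalPhysics.KineticTheory.TaggedSphereCarleman
import Literature.Analysis.FluidPDE.HardSpherePhaseSpace
import HarnessLib

/-!
# Gain spreading: one collision with the thermal bulk repopulates every cell of a velocity ball
# (`stub_gainSpreading`, registered stub S5 of the line `Sketch` of the crux
# `JParityClosure.RateFloor`, stmt-AtomisticToContinuum-13080)

The fifth registered stub of the lead's skeleton of the line `Sketch` for the crux `RateFloor`
(card `regeneration-spreading-uniformity`): the image of `1_{B_R}(v) M_β(w) ((w − v)·ω)₊ dω dw dv`
under the out-velocity map `(v, w, ω) ↦ v′ = (reflectVel ω (v, w)).1` dominates a multiple of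
Lebesgue measure on the ball `B_R`:
`c · vol(S) ≤ ∫_{v ∈ B_R} ∫_w ∫_ω 1_S(v′) ((w − v)·ω)₊ M_β(w)` for every measurable `S ⊆ B_R`, with
`c = c(β, R) > 0` (a Pulvirenti–Wennberg-type lower bound for the hard-sphere gain term with a
Maxwellian partner).

**Proof.**  For a unit impact direction `reflectVel ω = collide ω` (`reflectVel_eq_collide`); the
collision law is even in `ω` and `((w − v)·ω)₊ = ((v − w)·(−ω))₊`, so the antipodal symmetry of
the surface measure (`lintegral_sphere_neg`) turns the `ω`-integral into the tree's orientation
`∫_ω ((v − w)·ω)₊ M_β(w) 1_S((collide ω (v, w)).1) dω`.  The Carleman representation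
`lintegral_gain_eq_carleman` (TaggedSphereCarleman, `d = 3`) rewrites the two inner integrals as
`∫ k_β(v, u) 1_S(v + u) du`, and the lower bound `carlemanKernel_ge`,
`k_β(v, u) ≥ (2π/β) ‖u‖⁻¹ M_β(v + u)`, gives for `v ∈ B_R`, `v + u ∈ S ⊆ B_R`, `u ≠ 0`
(so `‖u‖ ≤ 2R`, `‖v + u‖ ≤ R`) the uniform floor `k_β(v, u) ≥ c₀(β, R) > 0`.  Hence, by
translation invariance of Lebesgue measure (`measure_preimage_add`; the point `u = 0` is null),
`∫ k_β(v, u) 1_S(v + u) du ≥ c₀ vol(S)` for every `v ∈ B_R`, and integrating over `v ∈ B_R`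
(a set of finite positive volume) gives the claim with `c = c₀ · vol(B_R)`.

References: Pulvirenti–Wennberg, Comm. Math. Phys. 183 (1997), Lemma 3.1 (spreading of the gain
term); Carleman representation as in Bodineau–Gallagher–Saint-Raymond, Invent. Math. 203 (2016)
§6.1.2; elementary given the tree's `TaggedSphereCarleman`.
-/

noncomputable section

namespace Summit.AtomisticToContinuum.HydrodynamicLimit.Theorems

open MeasureTheory Set Filter Topology
open scoped InnerProductSpace RealInnerProductSpace ENNReal
open Literature.Analysis.FluidPDE Literature.MathematicalPhysics.KineticTheory
open Literature.Analysis.FunctionSpaces (maxwellianBeta)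

namespace RateFloorGainSpreading

/-- The collision law does not see the orientation of the impact direction:
`collide (-ω) p = collide ω p`. [folklore] -/
theorem collide_neg_dir (ω : Metric.sphere (0 : V3) 1) (p : V3 × V3) :
    collide (-ω) p = collide ω p := by
  simp only [collide, coe_neg_sphere, inner_neg_right, smul_neg, neg_smul, neg_neg]

/-- Reversing the impact direction exchanges the roles of the two velocities in the hard-sphere
kernel: `((v − w)·(−ω))₊ = ((w − v)·ω)₊`. [folklore] -/
theorem hardSphereKernel_neg_dir (ω : Metric.sphere (0 : V3) 1) (v w : V3) :
    hardSphereKernel (v, w) (-ω) = hardSphereKernel (w, v) ω := by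
  simp only [hardSphereKernel, coe_neg_sphere, inner_neg_right, ← inner_neg_left, neg_sub]

/-- **Matching the integrand with the tree's orientation.**  By `reflectVel ω = collide ω`, the
evenness of `collide` in `ω`, `((w − v)·ω)₊ = ((v − w)·(−ω))₊` and the antipodal symmetry of the
surface measure, the `ω`-integral of the stub equals the gain integrand of
`lintegral_gain_eq_carleman` applied to `F = 1_S`. [folklore] -/
theorem lintegral_sphere_flip (β : ℝ) (S : Set V3) (v w : V3) :
    ∫⁻ ω : Metric.sphere (0 : V3) 1, S.indicator (fun _ => (1 : ℝ≥0∞)) (reflectVel (ω : V3) (v, w)).1 *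
        ENNReal.ofReal (hardSphereKernel (w, v) ω * maxwellianBeta β w) ∂sphereMeasure =
      ∫⁻ ω : Metric.sphere (0 : V3) 1,
        ENNReal.ofReal (hardSphereKernel (v, w) ω * maxwellianBeta β w) *
          S.indicator (fun _ => (1 : ℝ≥0∞)) (collide ω (v, w)).1 ∂sphereMeasure := by
  refine Eq.trans (lintegral_congr fun ω => ?_)
    (lintegral_sphere_neg (d := Fin 3) fun ν =>
      ENNReal.ofReal (hardSphereKernel (v, w) ν * maxwellianBeta β w) *
        S.indicator (fun _ => (1 : ℝ≥0∞)) (collide ν (v, w)).1)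
  rw [reflectVel_eq_collide, collide_neg_dir, hardSphereKernel_neg_dir, mul_comm]

/-- **Uniform floor of the Carleman kernel on a ball.**  For `β, R > 0` there is `c₀ > 0` with
`k_β(v, u) ≥ c₀` whenever `v ∈ B_R`, `v + u ∈ B_R` and `u ≠ 0`: from `carlemanKernel_ge`,
`k_β(v, u) ≥ (2π/β)^{(d-1)/2} ‖u‖^{2-d} M_β(v + u)` with `‖u‖ ≤ 2R` and `‖v + u‖ ≤ R`
(`d = 3`). [folklore] -/
theorem exists_carlemanKernel_floor {β R : ℝ} (hβ : 0 < β) (hR : 0 < R) :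
    ∃ c₀ : ℝ, 0 < c₀ ∧ ∀ v u : V3, v ∈ Metric.ball (0 : V3) R → v + u ∈ Metric.ball (0 : V3) R →
      u ≠ 0 → c₀ ≤ carlemanKernel β v u := by
  set n : ℕ := Fintype.card (Fin 3) - 2 with hn
  set C : ℝ := (2 * Real.pi * β⁻¹) ^ (((Fintype.card (Fin 3) : ℝ) - 1) / 2) with hC
  set A : ℝ := (2 * Real.pi * β⁻¹) ^ (-(Module.finrank ℝ (EuclideanSpace ℝ (Fin 3)) : ℝ) / 2)
    with hA
  have hCpos : 0 < C := Real.rpow_pos_of_pos (by positivity) _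
  have hApos : 0 < A := Real.rpow_pos_of_pos (by positivity) _
  refine ⟨C * ((2 * R) ^ n)⁻¹ * (A * Real.exp (-(β / 2) * R ^ 2)), by positivity,
    fun v u hv hvu hu => ?_⟩
  rw [Metric.mem_ball, dist_zero_right] at hv hvu
  have hnu : 0 < ‖u‖ := norm_pos_iff.2 hu
  have hu2R : ‖u‖ ≤ 2 * R := by
    have huvv : u = (v + u) - v := by abel
    calc ‖u‖ = ‖(v + u) - v‖ := by rw [← huvv]
      _ ≤ ‖v + u‖ + ‖v‖ := norm_sub_le _ _
      _ ≤ 2 * R := by linarith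
  have hinv : ((2 * R) ^ n)⁻¹ ≤ (‖u‖ ^ n)⁻¹ :=
    inv_anti₀ (pow_pos hnu n) (pow_le_pow_left₀ hnu.le hu2R n)
  have hM : A * Real.exp (-(β / 2) * R ^ 2) ≤ maxwellianBeta β (v + u) := by
    rw [maxwellianBeta_eq]
    refine mul_le_mul_of_nonneg_left (Real.exp_le_exp.2 ?_) hApos.le
    have h2 : ‖v + u‖ ^ 2 ≤ R ^ 2 := pow_le_pow_left₀ (norm_nonneg _) hvu.le 2
    nlinarith
  calc C * ((2 * R) ^ n)⁻¹ * (A * Real.exp (-(β / 2) * R ^ 2))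
      ≤ C * (‖u‖ ^ n)⁻¹ * maxwellianBeta β (v + u) :=
        mul_le_mul (mul_le_mul_of_nonneg_left hinv hCpos.le) hM (by positivity) (by positivity)
    _ ≤ carlemanKernel β v u := carlemanKernel_ge hβ v u

/-- **The floor per incoming velocity.**  If `k_β(v, u) ≥ c₀` whenever `v, v + u ∈ B_R`, `u ≠ 0`,
then for measurable `S ⊆ B_R` and `v ∈ B_R`, `c₀ vol(S) ≤ ∫ k_β(v, u) 1_S(v + u) du`
(translation invariance of Lebesgue measure; the origin is a null set). [folklore] -/
theorem lintegral_carleman_indicator_ge {β R c₀ : ℝ}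
    (hc₀ : ∀ v u : V3, v ∈ Metric.ball (0 : V3) R → v + u ∈ Metric.ball (0 : V3) R →
      u ≠ 0 → c₀ ≤ carlemanKernel β v u)
    {S : Set V3} (hS : MeasurableSet S) (hSR : S ⊆ Metric.ball (0 : V3) R) {v : V3}
    (hv : v ∈ Metric.ball (0 : V3) R) :
    ENNReal.ofReal c₀ * volume S ≤
      ∫⁻ u, ENNReal.ofReal (carlemanKernel β v u) * S.indicator (fun _ => (1 : ℝ≥0∞)) (v + u) := by
  set T : Set V3 := (fun u => v + u) ⁻¹' S with hT
  have hTm : MeasurableSet T := measurable_const_add v hS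
  have hTS : volume T = volume S := measure_preimage_add volume v S
  have hae : ∀ᵐ u ∂(volume : Measure V3), u ≠ 0 := by
    rw [ae_iff]
    simp
  calc ENNReal.ofReal c₀ * volume S = ENNReal.ofReal c₀ * volume T := by rw [hTS]
    _ = ∫⁻ u, T.indicator (fun _ => ENNReal.ofReal c₀) u := (lintegral_indicator_const hTm _).symm
    _ ≤ ∫⁻ u, ENNReal.ofReal (carlemanKernel β v u) * S.indicator (fun _ => (1 : ℝ≥0∞)) (v + u) := by
        refine lintegral_mono_ae (hae.mono fun u hu => ?_)
        by_cases huT : u ∈ T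
        · have huS : v + u ∈ S := huT
          rw [indicator_of_mem huT, indicator_of_mem huS, mul_one]
          exact ENNReal.ofReal_le_ofReal (hc₀ v u hv (hSR huS) hu)
        · rw [indicator_of_notMem huT]
          exact zero_le

/-- Registered stub S5 (`Stubs.stub_gainSpreading` of the lead's skeleton, verbatim): **gain
spreading** — for `β, R > 0` there is `c > 0` such that for every measurable `S ⊆ B_R`,
`c · vol(S) ≤ ∫_{v ∈ B_R} ∫_w ∫_ω 1_S((reflectVel ω (v, w)).1) ((w − v)·ω)₊ M_β(w) dω dw dv`.
Proof: `lintegral_sphere_flip` + the Carleman representation `lintegral_gain_eq_carleman` +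
the kernel floor `exists_carlemanKernel_floor` / `lintegral_carleman_indicator_ge`, integrated
over `v ∈ B_R`; `c = c₀ · vol(B_R)` (a Pulvirenti–Wennberg 1997 Lemma 3.1-type spreading bound,
elementary given the tree's Carleman representation). [folklore] -/
theorem stub_gainSpreading :
    ∀ β R : ℝ, 0 < β → 0 < R → ∃ c : ℝ, 0 < c ∧ ∀ S : Set V3, MeasurableSet S → S ⊆ Metric.ball (0 : V3) R →
    ENNReal.ofReal c * volume S ≤
      ∫⁻ v in Metric.ball (0 : V3) R, ∫⁻ w, ∫⁻ ω : Metric.sphere (0 : V3) 1,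
        S.indicator (fun _ => (1 : ℝ≥0∞)) (reflectVel (ω : V3) (v, w)).1 *
          ENNReal.ofReal (hardSphereKernel (w, v) ω * Literature.Analysis.FunctionSpaces.maxwellianBeta β w)
        ∂sphereMeasure := by
  intro β R hβ hR
  obtain ⟨c₀, hc₀, hfloor⟩ := exists_carlemanKernel_floor hβ hR
  have hball_pos : 0 < volume (Metric.ball (0 : V3) R) := Metric.measure_ball_pos volume 0 hR
  have hball_lt : volume (Metric.ball (0 : V3) R) < ∞ := measure_ball_lt_top
  refine ⟨c₀ * (volume (Metric.ball (0 : V3) R)).toReal,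
    mul_pos hc₀ (ENNReal.toReal_pos hball_pos.ne' hball_lt.ne), fun S hS hSR => ?_⟩
  have hF : Measurable (S.indicator fun _ => (1 : ℝ≥0∞)) := measurable_const.indicator hS
  -- the two inner integrals in Carleman form
  have hinner : ∀ v : V3,
      ∫⁻ w, ∫⁻ ω : Metric.sphere (0 : V3) 1,
        S.indicator (fun _ => (1 : ℝ≥0∞)) (reflectVel (ω : V3) (v, w)).1 *
          ENNReal.ofReal (hardSphereKernel (w, v) ω * maxwellianBeta β w) ∂sphereMeasure =
      ∫⁻ u, ENNReal.ofReal (carlemanKernel β v u) * S.indicator (fun _ => (1 : ℝ≥0∞)) (v + u) := by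
    intro v
    refine Eq.trans (lintegral_congr fun w => lintegral_sphere_flip β S v w) ?_
    exact lintegral_gain_eq_carleman (d := Fin 3) (by simp) hβ v hF
  calc ENNReal.ofReal (c₀ * (volume (Metric.ball (0 : V3) R)).toReal) * volume S
      = ENNReal.ofReal c₀ * volume S * volume (Metric.ball (0 : V3) R) := by
        rw [ENNReal.ofReal_mul hc₀.le, ENNReal.ofReal_toReal hball_lt.ne, mul_right_comm]
    _ = ∫⁻ _ in Metric.ball (0 : V3) R, ENNReal.ofReal c₀ * volume S := (setLIntegral_const _ _).symm
    _ ≤ _ := by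
        refine lintegral_mono_ae ((ae_restrict_iff' Metric.isOpen_ball.measurableSet).2
          (ae_of_all _ fun v hv => ?_))
        rw [hinner v]
        exact lintegral_carleman_indicator_ge hfloor hS hSR hv

end RateFloorGainSpreading

end Summit.AtomisticToContinuum.HydrodynamicLimit.Theorems

end
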